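/-
Copyright (c) 2026 the pub-hodgecm-mathlib formalisation cell (harness21).  Prover seat hodgecm-mathlib-LH4-p11 (g0), req620 Track A «(D-RAM) FOUR-FRAME» squad
(heir LEAD F0P3a-plan (g19) «FOUR-FRAME SKELETON LANDED» EMIT #8; dealer LH4-plan (g10)).  2026-09-03.
-/
import Literature.NumberTheory.Automorphic.UnitaryLatticeTreeFrameChange   -- ★ `mapGL_mapGL_inv`; brings ★ `UnitaryLatticeTreeDefs` (`mapGL`)
import HarnessLib

/-!
# Crux `H413`, line LH4 «(D-RAM) FOUR-FRAME» road — unit U3_Laws (iii), TIER 2 SUPPORT: THE TUBE CRITERION — AXIS-STABLE LATTICES ARE FIXED BY THE DIAGONAL TORUS ELEMENT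

Cell `hodgecm-mathlib` (D-0151), FLOOR 0, crux item H413 = `stmt-HodgeConjecture-24833`, route of record `HCCMUnconditional`; squad F0∕P3c∕LH4 (req618∕req620).  THEOREMS ONLY
(no `def`, no instance, no notation, no `sorry`, default heartbeats); lane `--supports stmt-HodgeConjecture-24833 --as helper` (count-neutral).

WHAT IS PROVED (generic `N`, any valued field).  In the diagonal model of a frame (★ `F0P3cDyRamFixedCountDiagonalModel`: the frame element is `T = diag(s)` on `(K^N, diag d)`,
the frame projections are the coordinate idempotents `E_ii`), the SUFFICIENT HALF of the fixed-vertex census — the «tube criterion» of the (S) structure probe (LH4-p11 (g0)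
DATUM §5, 2026-09-03): if for some slot `j` and every `i ≠ j` the lattice `M` absorbs `(s_i − s_j)·E_ii` (i.e. `(s_i − s_j)·x_i·e_i ∈ M` for all `x ∈ M` — in tree language
`dist(M, B_i) ≤ v(s_i − s_j)`, ★ #0a H13 `AxisStable`), then `diag(s)·M = M` (`s_i` units).  Because `diag(s) − s_j·1 = Σ_{i ≠ j} (s_i − s_j) E_ii`.  The necessary-and-sufficient
criterion needs ★ A-1's glue data (the «glue shells» of the DATUM); this file is the tube half every payer of the stable law uses first.
* `mulVec_diagonal_eq_smul_add_sum` — `diag(s)·x = s_j·x + Σ_i (s_i − s_j)·x_i·e_i`.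
* `mapGL_le_of_diagonal_of_forall_single_mem` — `diag(s)·M ≤ M` under the tube hypothesis (`|s_i| ≤ 1`).
* `mapGL_eq_of_diagonal_of_forall_single_mem` — `diag(s)·M = M` under the tube hypothesis (`|s_i| = 1`).
* `mapGL_eq_of_diagonal_of_axisStable` — the same with the hypothesis in ★ #0a H13 `AxisStable` currency: `ϖ^{c_i} E_ii·M ⊆ M` and `|s_i − s_j| ≤ |ϖ|^{c_i}` for `i ≠ j`.
HONEST LABEL.  Count-neutral; nothing printed is asserted; the census laws stay PROVER TARGETS; `HC_CM` is proved only modulo the 7 printed citations (2 remaining named inputs: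
hLiu418 = `stmt-HodgeConjecture-24832`, h413 = `stmt-HodgeConjecture-24833`) until rung 0 closes.

## References
* [Kottwitz1986BaseChangeUnits] R. E. Kottwitz, *Base change for unit elements of Hecke algebras*, Compositio Math. 60 (1986), §1 pp. 240–241 (fixed lattices of a torus element).
* [Serre1980Trees] J.-P. Serre, *Trees*, Springer (1980), Ch. II §1.1 (lattices and the action of diagonal elements).
* [BruhatTits1972] F. Bruhat, J. Tits, *Groupes réductifs sur un corps local I*, Publ. Math. IHÉS 41 (1972), §10.
-/

set_option autoImplicit false

noncomputable section

namespace Summit.HodgeConjecture.HodgeConjecture.Cruxes.H413.F0P3cDyRamDiagonalTubeFixed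

open Matrix
open Literature.NumberTheory.Automorphic Literature.NumberTheory.Automorphic.HermitianLattice
open Literature.NumberTheory.Automorphic.UnitaryLatticeTree
open scoped Valued WithZero Matrix MatrixGroups

variable {K : Type*} [Field K] [Valued K ℤᵐ⁰] {N : ℕ}

omit [Valued K ℤᵐ⁰] in
/-- `diag(s)·x = s_j·x + Σ_i (s_i − s_j)·x_i·e_i` (the `i = j` summand vanishes). [cite: Serre1980Trees, II §1.1] -/
theorem mulVec_diagonal_eq_smul_add_sum (s : Fin N → K) (j : Fin N) (x : Fin N → K) :
    (Matrix.diagonal s).mulVec x = s j • x + ∑ i, (s i - s j) • (Pi.single i (x i) : Fin N → K) := by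
  funext l
  rw [Matrix.mulVec_diagonal, Pi.add_apply, Finset.sum_apply, Pi.smul_apply, smul_eq_mul,
    Finset.sum_eq_single l (fun i _ hil => by rw [Pi.smul_apply, Pi.single_eq_of_ne (Ne.symm hil), smul_zero]) (fun h => absurd (Finset.mem_univ l) h),
    Pi.smul_apply, Pi.single_eq_same, smul_eq_mul]
  ring

/-- **THE TUBE CRITERION, `≤` HALF**: if `|s_i| ≤ 1` for all `i` and, for some slot `j`, `(s_i − s_j)·x_i·e_i ∈ M` for every `i ≠ j` and every `x ∈ M`, then `diag(s)·M ≤ M`.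
[cite: Kottwitz1986BaseChangeUnits, §1 pp. 240–241] [cite: Serre1980Trees, II §1.1] -/
theorem mapGL_le_of_diagonal_of_forall_single_mem (s : Fin N → K) (hs : ∀ i, Valued.v (s i) ≤ 1) (T : GL (Fin N) K)
    (hT : (T : Matrix (Fin N) (Fin N) K) = Matrix.diagonal s) (j : Fin N) (M : Submodule 𝒪[K] (Fin N → K))
    (h : ∀ i, i ≠ j → ∀ x ∈ M, (s i - s j) • (Pi.single i (x i) : Fin N → K) ∈ M) : mapGL T M ≤ M := by
  rw [mapGL, Submodule.map_le_iff_le_comap]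
  intro x hx
  rw [Submodule.mem_comap, LinearMap.restrictScalars_apply, Matrix.toLin'_apply, hT, mulVec_diagonal_eq_smul_add_sum s j x]
  refine M.add_mem ?_ (M.sum_mem fun i _ => ?_)
  · exact M.smul_mem (⟨s j, hs j⟩ : 𝒪[K]) hx
  · by_cases hij : i = j
    · subst hij; rw [sub_self, zero_smul]; exact M.zero_mem
    · exact h i hij x hx

/-- **THE TUBE CRITERION**: if every `s_i` is a unit (`|s_i| = 1`) and, for some slot `j`, `(s_i − s_j)·x_i·e_i ∈ M` for every `i ≠ j` and every `x ∈ M` (the lattice `M` is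
`(s_i − s_j)E_ii`-stable — `dist(M, B_i) ≤ v(s_i − s_j)` in the tree), then `diag(s)·M = M`.  (`≥`: the same for `diag(s)⁻¹ = diag(s⁻¹)`, whose differences
`s_i⁻¹ − s_j⁻¹ = −(s_i s_j)⁻¹(s_i − s_j)` are unit multiples of the old ones.) [cite: Kottwitz1986BaseChangeUnits, §1 pp. 240–241] [cite: BruhatTits1972, §10] -/
theorem mapGL_eq_of_diagonal_of_forall_single_mem (s : Fin N → K) (hs : ∀ i, Valued.v (s i) = 1) (T : GL (Fin N) K)
    (hT : (T : Matrix (Fin N) (Fin N) K) = Matrix.diagonal s) (j : Fin N) (M : Submodule 𝒪[K] (Fin N → K))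
    (h : ∀ i, i ≠ j → ∀ x ∈ M, (s i - s j) • (Pi.single i (x i) : Fin N → K) ∈ M) : mapGL T M = M := by
  classical
  have hs0 : ∀ i, s i ≠ 0 := fun i h0 => by have := hs i; rw [h0, map_zero] at this; exact zero_ne_one this
  refine le_antisymm (mapGL_le_of_diagonal_of_forall_single_mem s (fun i => (hs i).le) T hT j M h) ?_
  -- the inverse is the diagonal of `s⁻¹`, with unit entries, and satisfies the same tube hypothesis
  have hTinv : (((T⁻¹ : GL (Fin N) K)) : Matrix (Fin N) (Fin N) K) = Matrix.diagonal fun i => (s i)⁻¹ :=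
    Units.inv_eq_of_mul_eq_one_right (by
      rw [hT, Matrix.diagonal_mul_diagonal, ← Matrix.diagonal_one]
      congr 1; funext i; exact mul_inv_cancel₀ (hs0 i))
  have hs' : ∀ i, Valued.v (s i)⁻¹ ≤ 1 := fun i => by rw [map_inv₀, hs i, inv_one]
  have h' : ∀ i, i ≠ j → ∀ x ∈ M, ((s i)⁻¹ - (s j)⁻¹) • (Pi.single i (x i) : Fin N → K) ∈ M := by
    intro i hij x hx
    have hc : Valued.v (-((s i)⁻¹ * (s j)⁻¹)) ≤ 1 := by
      rw [Valuation.map_neg, map_mul, map_inv₀, map_inv₀, hs i, hs j, inv_one, mul_one]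
    have heq : ((s i)⁻¹ - (s j)⁻¹) • (Pi.single i (x i) : Fin N → K) = (-((s i)⁻¹ * (s j)⁻¹)) • ((s i - s j) • (Pi.single i (x i) : Fin N → K)) := by
      have hi := hs0 i
      have hj := hs0 j
      rw [smul_smul]; congr 1; field_simp; ring
    rw [heq]
    exact M.smul_mem (⟨-((s i)⁻¹ * (s j)⁻¹), hc⟩ : 𝒪[K]) (h i hij x hx)
  calc M = mapGL T (mapGL T⁻¹ M) := (mapGL_mapGL_inv T M).symm
    _ ≤ mapGL T M := Submodule.map_mono (mapGL_le_of_diagonal_of_forall_single_mem _ hs' T⁻¹ hTinv j M h')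

/-- **THE TUBE CRITERION IN AXIS-EXPONENT CURRENCY** (★ #0a H13 `AxisStable ϖ P Λ c := Λ.map (ϖ^c • P) ≤ Λ`, with `P = E_ii = Matrix.single i i 1` the coordinate idempotent
of the diagonal model): if `ϖ ≠ 0`, every `s_i` is a unit, and for some slot `j` and all `i ≠ j` the lattice `M` is `ϖ^{c_i} E_ii`-stable with `|s_i − s_j| ≤ |ϖ|^{c_i}`
(«`c_i(M) ≤ v(s_i − s_j)`», DATUM §5 (a)), then `diag(s)·M = M`. [cite: Kottwitz1986BaseChangeUnits, §1 pp. 240–241] [cite: Serre1980Trees, II §1.1] -/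
theorem mapGL_eq_of_diagonal_of_axisStable {ϖ : K} (hϖ0 : ϖ ≠ 0) (s : Fin N → K) (hs : ∀ i, Valued.v (s i) = 1) (T : GL (Fin N) K)
    (hT : (T : Matrix (Fin N) (Fin N) K) = Matrix.diagonal s) (j : Fin N) (M : Submodule 𝒪[K] (Fin N → K)) (c : Fin N → ℕ)
    (hax : ∀ i, i ≠ j → M.map ((Matrix.toLin' (ϖ ^ c i • Matrix.single i i (1 : K))).restrictScalars 𝒪[K]) ≤ M)
    (hle : ∀ i, i ≠ j → Valued.v (s i - s j) ≤ Valued.v ϖ ^ c i) : mapGL T M = M := by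
  refine mapGL_eq_of_diagonal_of_forall_single_mem s hs T hT j M fun i hij x hx => ?_
  have hϖc : (ϖ ^ c i : K) ≠ 0 := pow_ne_zero _ hϖ0
  -- `ϖ^{c_i}·x_i·e_i ∈ M` from the axis stability
  have hmem : ϖ ^ c i • (Pi.single i (x i) : Fin N → K) ∈ M := by
    have h1 := hax i hij (Submodule.mem_map.2 ⟨x, hx, rfl⟩)
    rw [LinearMap.restrictScalars_apply, Matrix.toLin'_apply, Matrix.smul_mulVec, Matrix.single_mulVec, one_mul] at h1
    exact h1
  -- rescale by the integer `(s_i − s_j) ∕ ϖ^{c_i}`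
  have hq : Valued.v ((s i - s j) / ϖ ^ c i) ≤ 1 := by
    rw [map_div₀, map_pow, div_le_one₀ (pow_pos ((Valuation.pos_iff _).2 hϖ0) _)]
    exact hle i hij
  have heq : (s i - s j) • (Pi.single i (x i) : Fin N → K) = ((s i - s j) / ϖ ^ c i) • (ϖ ^ c i • (Pi.single i (x i) : Fin N → K)) := by
    rw [smul_smul, div_mul_cancel₀ _ hϖc]
  rw [heq]
  exact M.smul_mem (⟨(s i - s j) / ϖ ^ c i, hq⟩ : 𝒪[K]) hmem

end Summit.HodgeConjecture.HodgeConjecture.Cruxes.H413.F0P3cDyRamDiagonalTubeFixed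

end
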